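import Summits.ResolutionOfSingularities.ResolutionOfSingularities.Theorems.PurelyInseparableDim4ResConeFourWeights
import Summits.ResolutionOfSingularities.ResolutionOfSingularities.Theorems.PurelyInseparableDim4ResConeLossFreeTail
import HarnessLib
import HarnessLib.Audit.Tags

/-!
# Purely inseparable four-folds — the RE-PRESENTATION SOCKETS of slice C at `p = 5`: the light `(5,3)` class, the light-pair `(5,4)`
# class and the D∞ `(5,4)` class each die from ONE named re-presentation hypothesis (hN4-C, hN4-C′, hN4-D) plus theorems in the tree
# (cell `res-dim4-pi`, K2(p) lane, slice C; holder brick S)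

[OURS · counted 0 · cell `res-dim4-pi` · K2(p) lane holder res-dim4-p-12 g4 (memo §17c).]  Nothing here proves K2(5)
(`RidgeBudget.NoAboveFloorTrap 5 5`), `NoIsolatedTrap 5 5` or resolution of singularities in dimension ≥ 4 / characteristic `p` —
NOT proved; every theorem below is CONDITIONAL on a named re-presentation hypothesis of the hN4 type (route of record for the light
class: res-dim4-idea-1 g7 06:24Z «C13 ∘ RE-PRESENTATION», one-step twin res-dim4-p-1 g4 `lossy_step_twin` p703100).  AI kernel
work, weaker than expert review.

A witnessed chain presents each infinitely-near point in ONE chart; the same point has other presentations (another chart letter,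
translated free letters), with the same weights up to the newborn letter's name.  A step is GENUINELY lossy only when ≥ 2 boundary
coordinates of its point are non-zero; in the light classes that breaks the floor, so light tails are loss-free UP TO PRESENTATION,
and loss-free tails are dead (`ResCone.no_lossfree_tail`, res-dim4-p-5 g3, p684130).  This file fixes the three re-presentation
hypotheses as BINDERS and proves the kills from them:
* **`no_light_three_tail_of_representation (hN4C)`** — `(5,3)`, light branch of W `three_weights_dichotomy`: if every light shade-`3`
  `e_G = 2` tail admits a LOSS-FREE re-presentation with the same tail data, the light branch is empty (C13 at `d = 3`);
* **`no_light_pair_tail_of_representation (hN4C')`** — `(5,4)`, light-pair branch of W₄ `four_weights_dichotomy`: likewise (C13 at `d = 4`);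
* **`no_dInf_tail_of_representation (hN4D) (hpair)`** — `(5,4)`, D∞ branch: if every D∞ tail admits a PAIR-CONFINED PASSIVE-FREE
  re-presentation (chart letters in a pair `{a, a′}`, the other two letters never boundary), then the D∞ branch is empty GIVEN the
  pair-tail kill `hpair` (= res-dim4-p-5 g4's `no_pair_tail_four_five`, `…TiltedTail`, stated here as a binder verbatim);
* **`tailD_of_representations (hN4C') (hN4D) (hpair)`** — the socket's TAIL-D block (`…SliceCSocket` p700823) from the three, by W₄.
So, with the B∞ assembly (`…BInfPotential` p702997 / res-dim4-p-9's `…BInfAssembly`), slice C at `p = 5` is reduced to: the Φ-line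
stubs K/L, the pair-tail kill, and three re-presentation hypotheses of the hN4 type.  Nothing more is claimed.

[cite: CossartJannsenSaito2020, Thm. 3.10(4), Thm. 3.14] [cite: HauserPerlega2019PRIMS, §2 (transform D′ of D)]
bears_on: LADDER-RESOLUTION:D157-DOOR2 (res-dim4-pi · K2(p) · slice C re-presentation sockets).  Supports
stmt-ResolutionOfSingularities-16155 (helper).
-/

set_option linter.dupNamespace false -- mandated namespace of this single-conjunct summit

noncomputable section

namespace Summit.ResolutionOfSingularities.ResolutionOfSingularities.Theorems.PIDim4

namespace ResCone

open MvPolynomial Finset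
open Literature.AlgebraicGeometry.Resolution
open Literature.AlgebraicGeometry.Resolution.CentreBlowup
open Literature.AlgebraicGeometry.Resolution.Hauser2010
open Literature.AlgebraicGeometry.Resolution.HauserPerlega2019

variable {K : Type} [Field K] [CharP K 5] [DecidableEq K]

/-- **(5,3) LIGHT CLASS ⟸ hN4-C.**  If every witnessed isolated above-floor `Step0 5` chain with `x^{r₀} ∣ F₀`, shade `≡ 3`, `e_G ≡ 2`
and all weights `≤ 1` from `k₀` admits a LOSS-FREE re-presentation with the same tail data (hN4-C), then no such chain exists
(`no_lossfree_tail` at `d = 3`). [OURS · conditional on hN4-C] [cite: CossartJannsenSaito2020, Thm. 3.14] -/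
theorem no_light_three_tail_of_representation
    (hN4C : ∀ (c : ℕ → State K) (j : ℕ → Fin 4) (b : ℕ → Fin 4 → K),
      (∀ k, IsIsolated 5 (c k).F ∧ Step0 5 (c k) (c (k + 1))) → FreeTail.IsWitnessedChain 5 c j b →
      (∀ e ∈ (c 0).F.support, (c 0).r ≤ e) → (∀ k, ordZero (c k).F ≠ (5 : ℕ)) →
      ∀ k₀ : ℕ, (∀ k, k₀ ≤ k → (c k).shade = ((3 : ℕ) : ℕ∞)) →
      (∀ k, k₀ ≤ k → Module.finrank K (resVertex (c k)) = 2) →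
      (∀ k, k₀ ≤ k → (∀ i, (c k).r i ≤ 1) ∧ (c k).r.degree = 3) →
      ∃ (c' : ℕ → State K) (j' : ℕ → Fin 4) (b' : ℕ → Fin 4 → K) (k₀' : ℕ),
        (∀ k, IsIsolated 5 (c' k).F ∧ Step0 5 (c' k) (c' (k + 1))) ∧ FreeTail.IsWitnessedChain 5 c' j' b' ∧
        (∀ e ∈ (c' 0).F.support, (c' 0).r ≤ e) ∧ (∀ k, ordZero (c' k).F ≠ (5 : ℕ)) ∧
        (∀ k, k₀' ≤ k → (c' k).shade = ((3 : ℕ) : ℕ∞)) ∧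
        (∀ k, k₀' ≤ k → Module.finrank K (resVertex (c' k)) = 2) ∧
        (∀ k, k₀' ≤ k → ∀ i, b' k i ≠ 0 → (c' k).r i = 0))
    (c : ℕ → State K) (j : ℕ → Fin 4) (b : ℕ → Fin 4 → K)
    (hc : ∀ k, IsIsolated 5 (c k).F ∧ Step0 5 (c k) (c (k + 1))) (hw : FreeTail.IsWitnessedChain 5 c j b)
    (hr0 : ∀ e ∈ (c 0).F.support, (c 0).r ≤ e) (hfloor : ∀ k, ordZero (c k).F ≠ (5 : ℕ)) (k₀ : ℕ)
    (hshade : ∀ k, k₀ ≤ k → (c k).shade = ((3 : ℕ) : ℕ∞))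
    (he : ∀ k, k₀ ≤ k → Module.finrank K (resVertex (c k)) = 2)
    (hlight : ∀ k, k₀ ≤ k → (∀ i, (c k).r i ≤ 1) ∧ (c k).r.degree = 3) : False := by
  haveI : Fact (Nat.Prime 5) := ⟨by norm_num⟩
  obtain ⟨c', j', b', k₀', hc', hw', hr0', hfloor', hshade', he', hloss'⟩ :=
    hN4C c j b hc hw hr0 hfloor k₀ hshade he hlight
  exact no_lossfree_tail 5 hc' hw' hr0' (fun k => by exact_mod_cast hfloor' k) (d := 3) (by norm_num) hshade' he' hloss'

/-- **(5,4) LIGHT-PAIR CLASS ⟸ hN4-C′.**  If every witnessed isolated above-floor `Step0 5` chain with `x^{r₀} ∣ F₀`, shade `≡ 4`,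
`e_G ≡ 2` and light-pair weights (`|r| = 2`, weights `≤ 1`) from `k₀` admits a LOSS-FREE re-presentation with the same tail data
(hN4-C′), then no such chain exists (`no_lossfree_tail` at `d = 4`). [OURS · conditional on hN4-C′] [cite: CossartJannsenSaito2020, Thm. 3.14] -/
theorem no_light_pair_tail_of_representation
    (hN4C' : ∀ (c : ℕ → State K) (j : ℕ → Fin 4) (b : ℕ → Fin 4 → K),
      (∀ k, IsIsolated 5 (c k).F ∧ Step0 5 (c k) (c (k + 1))) → FreeTail.IsWitnessedChain 5 c j b →
      (∀ e ∈ (c 0).F.support, (c 0).r ≤ e) → (∀ k, ordZero (c k).F ≠ (5 : ℕ)) →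
      ∀ k₀ : ℕ, (∀ k, k₀ ≤ k → (c k).shade = ((4 : ℕ) : ℕ∞)) →
      (∀ k, k₀ ≤ k → Module.finrank K (resVertex (c k)) = 2) →
      (∀ k, k₀ ≤ k → (∀ i, (c k).r i ≤ 1) ∧ (c k).r.degree = 2) →
      ∃ (c' : ℕ → State K) (j' : ℕ → Fin 4) (b' : ℕ → Fin 4 → K) (k₀' : ℕ),
        (∀ k, IsIsolated 5 (c' k).F ∧ Step0 5 (c' k) (c' (k + 1))) ∧ FreeTail.IsWitnessedChain 5 c' j' b' ∧
        (∀ e ∈ (c' 0).F.support, (c' 0).r ≤ e) ∧ (∀ k, ordZero (c' k).F ≠ (5 : ℕ)) ∧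
        (∀ k, k₀' ≤ k → (c' k).shade = ((4 : ℕ) : ℕ∞)) ∧
        (∀ k, k₀' ≤ k → Module.finrank K (resVertex (c' k)) = 2) ∧
        (∀ k, k₀' ≤ k → ∀ i, b' k i ≠ 0 → (c' k).r i = 0))
    (c : ℕ → State K) (j : ℕ → Fin 4) (b : ℕ → Fin 4 → K)
    (hc : ∀ k, IsIsolated 5 (c k).F ∧ Step0 5 (c k) (c (k + 1))) (hw : FreeTail.IsWitnessedChain 5 c j b)
    (hr0 : ∀ e ∈ (c 0).F.support, (c 0).r ≤ e) (hfloor : ∀ k, ordZero (c k).F ≠ (5 : ℕ)) (k₀ : ℕ)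
    (hshade : ∀ k, k₀ ≤ k → (c k).shade = ((4 : ℕ) : ℕ∞))
    (he : ∀ k, k₀ ≤ k → Module.finrank K (resVertex (c k)) = 2)
    (hlight : ∀ k, k₀ ≤ k → (∀ i, (c k).r i ≤ 1) ∧ (c k).r.degree = 2) : False := by
  haveI : Fact (Nat.Prime 5) := ⟨by norm_num⟩
  obtain ⟨c', j', b', k₀', hc', hw', hr0', hfloor', hshade', he', hloss'⟩ :=
    hN4C' c j b hc hw hr0 hfloor k₀ hshade he hlight
  exact no_lossfree_tail 5 hc' hw' hr0' (fun k => by exact_mod_cast hfloor' k) (d := 4) (by norm_num) hshade' he' hloss'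

omit [CharP K 5] in
/-- **(5,4) D∞ CLASS ⟸ hN4-D + the pair-tail kill.**  If every witnessed isolated above-floor `Step0 5` chain with `x^{r₀} ∣ F₀`,
shade `≡ 4`, `e_G ≡ 2` in the D∞ branch (one weight-`2` letter, others `≤ 1`, `|r| ∈ {2,3}` from `k₁`; W₄ `four_weights_dichotomy`)
admits a PAIR-CONFINED PASSIVE-FREE re-presentation (hN4-D: chart letters in a pair `{a,a′}`, the other letters never boundary, same
tail data), then no such chain exists GIVEN the pair-tail kill `hpair` (res-dim4-p-5 g4's `no_pair_tail_four_five`, binder verbatim).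
[OURS · conditional on hN4-D and `hpair`] [cite: CossartJannsenSaito2020, Thm. 3.14] -/
theorem no_dInf_tail_of_representation
    (hN4D : ∀ (c : ℕ → State K) (j : ℕ → Fin 4) (b : ℕ → Fin 4 → K),
      (∀ k, IsIsolated 5 (c k).F ∧ Step0 5 (c k) (c (k + 1))) → FreeTail.IsWitnessedChain 5 c j b →
      (∀ e ∈ (c 0).F.support, (c 0).r ≤ e) → (∀ k, ordZero (c k).F ≠ (5 : ℕ)) →
      ∀ k₀ : ℕ, (∀ k, k₀ ≤ k → (c k).shade = ((4 : ℕ) : ℕ∞)) →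
      (∀ k, k₀ ≤ k → Module.finrank K (resVertex (c k)) = 2) →
      ∀ k₁ : ℕ, k₀ ≤ k₁ → (∀ k, k₁ ≤ k → (∃ W, (c k).r W = 2 ∧ ∀ i, i ≠ W → (c k).r i ≤ 1) ∧
        (2 ≤ (c k).r.degree ∧ (c k).r.degree ≤ 3)) →
      ∃ (c' : ℕ → State K) (j' : ℕ → Fin 4) (b' : ℕ → Fin 4 → K) (k₀' : ℕ) (a a' : Fin 4),
        (∀ k, IsIsolated 5 (c' k).F ∧ Step0 5 (c' k) (c' (k + 1))) ∧ FreeTail.IsWitnessedChain 5 c' j' b' ∧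
        (∀ e ∈ (c' 0).F.support, (c' 0).r ≤ e) ∧ (∀ k, ordZero (c' k).F ≠ (5 : ℕ)) ∧
        (∀ k, k₀' ≤ k → (c' k).shade = ((4 : ℕ) : ℕ∞)) ∧
        (∀ k, k₀' ≤ k → Module.finrank K (resVertex (c' k)) = 2) ∧ a ≠ a' ∧
        (∀ k, k₀' ≤ k → (j' k = a ∨ j' k = a')) ∧
        (∀ k, k₀' ≤ k → ∀ i, i ≠ a → i ≠ a' → (c' k).r i = 0))
    (hpair : ∀ (c : ℕ → State K) (j : ℕ → Fin 4) (b : ℕ → Fin 4 → K),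
      (∀ k, IsIsolated 5 (c k).F ∧ Step0 5 (c k) (c (k + 1))) → FreeTail.IsWitnessedChain 5 c j b →
      (∀ e ∈ (c 0).F.support, (c 0).r ≤ e) → (∀ k, ordZero (c k).F ≠ (5 : ℕ)) →
      ∀ k₀ : ℕ, (∀ k, k₀ ≤ k → (c k).shade = ((4 : ℕ) : ℕ∞)) →
      (∀ k, k₀ ≤ k → Module.finrank K (resVertex (c k)) = 2) → ∀ a a' : Fin 4, a ≠ a' →
      (∀ k, k₀ ≤ k → (j k = a ∨ j k = a')) →
      (∀ k, k₀ ≤ k → ∀ i, i ≠ a → i ≠ a' → (c k).r i = 0) → False)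
    (c : ℕ → State K) (j : ℕ → Fin 4) (b : ℕ → Fin 4 → K)
    (hc : ∀ k, IsIsolated 5 (c k).F ∧ Step0 5 (c k) (c (k + 1))) (hw : FreeTail.IsWitnessedChain 5 c j b)
    (hr0 : ∀ e ∈ (c 0).F.support, (c 0).r ≤ e) (hfloor : ∀ k, ordZero (c k).F ≠ (5 : ℕ)) (k₀ : ℕ)
    (hshade : ∀ k, k₀ ≤ k → (c k).shade = ((4 : ℕ) : ℕ∞))
    (he : ∀ k, k₀ ≤ k → Module.finrank K (resVertex (c k)) = 2) (k₁ : ℕ) (hk₁ : k₀ ≤ k₁)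
    (hD : ∀ k, k₁ ≤ k → (∃ W, (c k).r W = 2 ∧ ∀ i, i ≠ W → (c k).r i ≤ 1) ∧
      (2 ≤ (c k).r.degree ∧ (c k).r.degree ≤ 3)) : False := by
  obtain ⟨c', j', b', k₀', a, a', hc', hw', hr0', hfloor', hshade', he', haa, hletters, hpass⟩ :=
    hN4D c j b hc hw hr0 hfloor k₀ hshade he k₁ hk₁ hD
  exact hpair c' j' b' hc' hw' hr0' hfloor' k₀' hshade' he' a a' haa hletters hpass

/-- **TAIL-D FROM THE TWO `(5,4)` RE-PRESENTATION HYPOTHESES AND THE PAIR-TAIL KILL**: the socket's `d = 4` block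
(`…SliceCSocket.noAboveFloorTrap_five_iff_no_binaryCone_tails`, TAIL-D) for every chain, by W₄'s `four_weights_dichotomy`.
[OURS · conditional on hN4-C′, hN4-D, `hpair`] [cite: CossartJannsenSaito2020, Thm. 3.14] -/
theorem tailD_of_representations
    (hN4C' : ∀ (c : ℕ → State K) (j : ℕ → Fin 4) (b : ℕ → Fin 4 → K),
      (∀ k, IsIsolated 5 (c k).F ∧ Step0 5 (c k) (c (k + 1))) → FreeTail.IsWitnessedChain 5 c j b →
      (∀ e ∈ (c 0).F.support, (c 0).r ≤ e) → (∀ k, ordZero (c k).F ≠ (5 : ℕ)) →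
      ∀ k₀ : ℕ, (∀ k, k₀ ≤ k → (c k).shade = ((4 : ℕ) : ℕ∞)) →
      (∀ k, k₀ ≤ k → Module.finrank K (resVertex (c k)) = 2) →
      (∀ k, k₀ ≤ k → (∀ i, (c k).r i ≤ 1) ∧ (c k).r.degree = 2) →
      ∃ (c' : ℕ → State K) (j' : ℕ → Fin 4) (b' : ℕ → Fin 4 → K) (k₀' : ℕ),
        (∀ k, IsIsolated 5 (c' k).F ∧ Step0 5 (c' k) (c' (k + 1))) ∧ FreeTail.IsWitnessedChain 5 c' j' b' ∧
        (∀ e ∈ (c' 0).F.support, (c' 0).r ≤ e) ∧ (∀ k, ordZero (c' k).F ≠ (5 : ℕ)) ∧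
        (∀ k, k₀' ≤ k → (c' k).shade = ((4 : ℕ) : ℕ∞)) ∧
        (∀ k, k₀' ≤ k → Module.finrank K (resVertex (c' k)) = 2) ∧
        (∀ k, k₀' ≤ k → ∀ i, b' k i ≠ 0 → (c' k).r i = 0))
    (hN4D : ∀ (c : ℕ → State K) (j : ℕ → Fin 4) (b : ℕ → Fin 4 → K),
      (∀ k, IsIsolated 5 (c k).F ∧ Step0 5 (c k) (c (k + 1))) → FreeTail.IsWitnessedChain 5 c j b →
      (∀ e ∈ (c 0).F.support, (c 0).r ≤ e) → (∀ k, ordZero (c k).F ≠ (5 : ℕ)) →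
      ∀ k₀ : ℕ, (∀ k, k₀ ≤ k → (c k).shade = ((4 : ℕ) : ℕ∞)) →
      (∀ k, k₀ ≤ k → Module.finrank K (resVertex (c k)) = 2) →
      ∀ k₁ : ℕ, k₀ ≤ k₁ → (∀ k, k₁ ≤ k → (∃ W, (c k).r W = 2 ∧ ∀ i, i ≠ W → (c k).r i ≤ 1) ∧
        (2 ≤ (c k).r.degree ∧ (c k).r.degree ≤ 3)) →
      ∃ (c' : ℕ → State K) (j' : ℕ → Fin 4) (b' : ℕ → Fin 4 → K) (k₀' : ℕ) (a a' : Fin 4),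
        (∀ k, IsIsolated 5 (c' k).F ∧ Step0 5 (c' k) (c' (k + 1))) ∧ FreeTail.IsWitnessedChain 5 c' j' b' ∧
        (∀ e ∈ (c' 0).F.support, (c' 0).r ≤ e) ∧ (∀ k, ordZero (c' k).F ≠ (5 : ℕ)) ∧
        (∀ k, k₀' ≤ k → (c' k).shade = ((4 : ℕ) : ℕ∞)) ∧
        (∀ k, k₀' ≤ k → Module.finrank K (resVertex (c' k)) = 2) ∧ a ≠ a' ∧
        (∀ k, k₀' ≤ k → (j' k = a ∨ j' k = a')) ∧
        (∀ k, k₀' ≤ k → ∀ i, i ≠ a → i ≠ a' → (c' k).r i = 0))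
    (hpair : ∀ (c : ℕ → State K) (j : ℕ → Fin 4) (b : ℕ → Fin 4 → K),
      (∀ k, IsIsolated 5 (c k).F ∧ Step0 5 (c k) (c (k + 1))) → FreeTail.IsWitnessedChain 5 c j b →
      (∀ e ∈ (c 0).F.support, (c 0).r ≤ e) → (∀ k, ordZero (c k).F ≠ (5 : ℕ)) →
      ∀ k₀ : ℕ, (∀ k, k₀ ≤ k → (c k).shade = ((4 : ℕ) : ℕ∞)) →
      (∀ k, k₀ ≤ k → Module.finrank K (resVertex (c k)) = 2) → ∀ a a' : Fin 4, a ≠ a' →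
      (∀ k, k₀ ≤ k → (j k = a ∨ j k = a')) →
      (∀ k, k₀ ≤ k → ∀ i, i ≠ a → i ≠ a' → (c k).r i = 0) → False)
    (c : ℕ → State K) (j : ℕ → Fin 4) (b : ℕ → Fin 4 → K)
    (hc : ∀ k, IsIsolated 5 (c k).F ∧ Step0 5 (c k) (c (k + 1))) (hw : FreeTail.IsWitnessedChain 5 c j b)
    (hr0 : ∀ e ∈ (c 0).F.support, (c 0).r ≤ e) (hfloor : ∀ k, ordZero (c k).F ≠ (5 : ℕ)) (k₀ : ℕ)
    (hshade : ∀ k, k₀ ≤ k → (c k).shade = ((4 : ℕ) : ℕ∞))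
    (he : ∀ k, k₀ ≤ k → Module.finrank K (resVertex (c k)) = 2) : False := by
  have hfloor' : ∀ k, ordZero (c k).F ≠ 5 := fun k => by exact_mod_cast hfloor k
  rcases four_weights_dichotomy hc hw hr0 hfloor' hshade with hL | ⟨k₁, hk₁, hD⟩
  · exact no_light_pair_tail_of_representation hN4C' c j b hc hw hr0 hfloor k₀ hshade he hL
  · exact no_dInf_tail_of_representation hN4D hpair c j b hc hw hr0 hfloor k₀ hshade he k₁ hk₁ hD

end ResCone

end Summit.ResolutionOfSingularities.ResolutionOfSingularities.Theorems.PIDim4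

end
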